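import Literature.ModelTheory.ExponentialFields.DefinitionalExpansion
import Literature.ModelTheory.ExponentialFields.RealExpModels
import Mathlib.ModelTheory.Order
import HarnessLib

/-!
# The theory `T_e = Th(ℝ; +, ·, -, 0, 1, e, ≤)`, `e(x) = exp((1 + x²)⁻¹)`, and the `e`-reducts of the models of `T_exp`

Topic `Literature/ModelTheory/ExponentialFields`.  In the proof of his Second Main Theorem
(the model completeness of `T_exp = Th(ℝ; +, ·, -, 0, 1, exp, ≤)`), Wilkie replaces the
restricted exponential `exp↾[0, 1]` by the total analytic function `e(x) = exp((1 + x²)⁻¹)`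
(A. J. Wilkie, J. Amer. Math. Soc. 9 (1996), Example (A), p. 1053, and §9, §11, Theorem 11.1:
"`T_e` is smooth and model complete"); M. den Besten, *Wilkie's Theorem and the Uniform Real
Schanuel Conjecture* (MSc thesis, Utrecht 2016), Definition 6.2.2, fixes the language
`L_e = {+, ·, -, 0, 1, <} ∪ {e}` and the complete theory `T_e = Th(ℝ | L_e)`, and uses
throughout chapters 6–7 that **every model `K` of `T_exp` is, with `e` interpreted by
`exp((1 + x²)⁻¹)`, a model of `T_e`, and every inclusion `k ⊆ K` of models of `T_exp` an
inclusion of `L_e`-structures** (proof of Theorem 6.1.2, p. 75; Lemma 7.2.4).  This file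
provides exactly this infrastructure, sorry-free and without named facts:

* `Language.eUnary` (the one-symbol language `{e}`), `Language.orderedERing = L_e`
  (`= Language.orderedRing.sum Language.eUnary`) and
  `Language.orderedExpERing = L_exp ∪ {e}`; the class `EFun` interpreting `e`, with the
  instances `e(x) = exp((1 + x²)⁻¹)` on `ℝ` and on every model `K` of `T_exp`
  (`RealExpModel.e_def`);
* `eDefs`: the explicit `L_exp`-definition `∃ u (u · (1 + x·x) = 1 ∧ y = exp u)` of `e`, and
  the facts that `ℝ` and every `K ⊨ T_exp` are definitional expansions along it
  (`eDefs_isDefinedBy_real`, `RealExpModel.eDefs_isDefinedBy`);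
* `eTheory = T_e := Th(ℝ | L_e)` (den Besten, Definition 6.2.2), complete
  (`eTheory_isComplete`), and **`K ⊨ T_e` for every `K ⊨ T_exp`**
  (`RealExpModel.model_eTheory`, by `Definitions.IsDefinedBy.models_completeTheory_sum` of
  `DefinitionalExpansion.lean`), with the transfer principle
  `RealExpModel.realize_eSentence_iff_real` and the bundled model `RealExpModel.eModel K`;
* `L_e` is an ordered language and `K`, `ℝ` are ordered `L_e`-structures (instances), so that
  the o-minimality toolkit (`Language.IsOMinimal`, `OMinimal*.lean`) applies to `K | L_e`;
* `RealExpModel.definable_of_definable_orderedERing`: `L_e`-definable sets of a model of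
  `T_exp` are `L_exp`-definable (same parameters);
* `RealExpModel.eEmbedding f`: an embedding `f : k ↪[L_exp] K` of models of `T_exp` is an
  embedding of `L_e`-structures (`RealExpModel.map_e`).

What is NOT here: the model completeness / o-minimality / polynomial boundedness of `T_e`
(Wilkie's First Main Theorem and Theorem 11.1; den Besten, Corollary 6.2.4, Theorem 7.2.1) —
these are the open formalization targets (V1)–(V2) recorded in `Wilkie1996.lean`.

## References

* A. J. Wilkie, *Model completeness results for expansions of the ordered field of real numbers
  by restricted Pfaffian functions and the exponential function*, J. Amer. Math. Soc. 9 (1996)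
  1051–1094: Example (A) p. 1053; §9 p. 1084; Theorem 11.1 p. 1091. [WilkieJAMS1996]
* M. den Besten, *Wilkie's Theorem and the Uniform Real Schanuel Conjecture*, MSc thesis,
  Utrecht 2016: Definition 6.2.2, Lemma 6.2.3, Corollary 6.2.4, p. 75. [DenBesten2016]
-/

noncomputable section

open FirstOrder FirstOrder.Language FirstOrder.Language.Structure
open scoped FirstOrder

namespace Literature.ModelTheory.ExponentialFields

universe w

/-! ### The languages `{e}`, `L_e` and `L_exp ∪ {e}` -/

/-- The function symbols of the one-symbol language `{e}`: a single unary symbol `e`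
(den Besten 2016, Definition 6.2.2). [cite: DenBesten2016, Definition 6.2.2] -/
inductive eFunc : ℕ → Type
  | e : eFunc 1
  deriving DecidableEq

/-- The language `{e}` with one unary function symbol and no relation symbols
(den Besten 2016, Definition 6.2.2: `L_e = L ∪ {e}`). [cite: DenBesten2016, Definition 6.2.2] -/
abbrev Language.eUnary : Language :=
  { Functions := eFunc
    Relations := fun _ => Empty }

/-- `{e}` has no relation symbols. [folklore] -/
instance Language.eUnary.instIsAlgebraic : Language.eUnary.IsAlgebraic :=
  fun _ => inferInstanceAs (IsEmpty Empty)

/-- **The language `L_e = {+, ·, -, 0, 1, ≤} ∪ {e}`** of den Besten 2016, Definition 6.2.2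
(Wilkie 1996, §9: the language of `T_e`), as the sum of the language of ordered rings and `{e}`.
[cite: DenBesten2016, Definition 6.2.2] -/
abbrev Language.orderedERing : Language :=
  Language.orderedRing.sum Language.eUnary

/-- The language `L_exp ∪ {e} = {+, ·, -, 0, 1, exp, ≤} ∪ {e}`, in which `e` is explicitly
definable from `exp` (den Besten 2016, proof of Lemma 6.2.3). [cite: DenBesten2016, Lemma 6.2.3] -/
abbrev Language.orderedExpERing : Language :=
  Language.orderedExpRing.sum Language.eUnary

/-- `≤` (the left summand's order symbol) is the order symbol of `L_e`. [folklore] -/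
instance Language.orderedERing.instIsOrdered : Language.orderedERing.IsOrdered :=
  ⟨Sum.inl Language.orderRel.le⟩

/-- The inclusion `L_e → L_exp ∪ {e}` (identity on `e`, the inclusion of ordered rings into
ordered exponential rings on the rest). [folklore] -/
abbrev orderedERingHom : Language.orderedERing →ᴸ Language.orderedExpERing :=
  orderedRingHomOrderedExpRing.sumMap (LHom.id Language.eUnary)

/-! ### Interpreting `e` -/

/-- A carrier with a distinguished unary function `e` (the intended interpretation being
`e(x) = exp((1 + x²)⁻¹)`, Wilkie 1996, Example (A), p. 1053). [cite: WilkieJAMS1996, Example (A) p. 1053] -/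
class EFun (M : Type*) where
  /-- the function interpreting the symbol `e` -/
  e : M → M

/-- Any type with an `EFun` is a structure for the language `{e}`. [folklore] -/
instance Language.eUnary.instStructure {M : Type*} [EFun M] : Language.eUnary.Structure M where
  funMap := fun {n} f v =>
    match n, f with
    | _, eFunc.e => EFun.e (v 0)
  RelMap := fun {n} r _ => by cases n <;> exact r.elim

/-- The symbol `e` is interpreted by `EFun.e`. [folklore] -/
@[simp]
theorem Language.eUnary.funMap_e {M : Type*} [EFun M] (v : Fin 1 → M) :
    funMap (L := Language.eUnary) eFunc.e v = EFun.e (v 0) :=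
  rfl

/-- In `L_e` (and in `L_exp ∪ {e}`), the symbol `e` is interpreted by `EFun.e`. [folklore] -/
@[simp]
theorem Language.orderedERing.funMap_e {L : Language} {M : Type*} [L.Structure M] [EFun M]
    (v : Fin 1 → M) :
    funMap (L := L.sum Language.eUnary) (Sum.inr eFunc.e : (L.sum Language.eUnary).Functions 1) v
      = EFun.e (v 0) :=
  rfl

/-- **`e(x) = exp((1 + x²)⁻¹)` on `ℝ`** (Wilkie 1996, Example (A), p. 1053; den Besten 2016,
Definition 6.2.2). [cite: WilkieJAMS1996, Example (A) p. 1053] -/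
instance Real.instEFun : EFun ℝ :=
  ⟨fun x => Real.exp ((1 + x ^ 2)⁻¹)⟩

/-- Unfolding `e` on `ℝ`. [cite: WilkieJAMS1996, Example (A) p. 1053] -/
theorem Real.e_def (x : ℝ) : EFun.e x = Real.exp ((1 + x ^ 2)⁻¹) :=
  rfl

/-- **`e(x) = exp((1 + x²)⁻¹)` on a model `K` of `T_exp`** (den Besten 2016, p. 75: "`K`, with
the obvious interpretation of `e`"; the generator `vᵢ = e(xᵢ)` of Wilkie's rings `Mˢₙ`,
`RealExpModel.msVal`). [cite: DenBesten2016, Definition 6.2.5] -/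
instance RealExpModel.instEFun (K : Language.Theory.ModelType.{0, 0, w} realExpTheory) : EFun K :=
  ⟨fun x => RealExpModel.exp ((1 + x ^ 2)⁻¹)⟩

/-- Unfolding `e` on a model of `T_exp`. [cite: DenBesten2016, Definition 6.2.5] -/
theorem RealExpModel.e_def {K : Language.Theory.ModelType.{0, 0, w} realExpTheory} (x : K) :
    EFun.e x = RealExpModel.exp ((1 + x ^ 2)⁻¹) :=
  rfl

/-! ### `L_e`-structures are ordered structures -/

section Ordered

variable {M : Type*} [Add M] [Mul M] [Neg M] [Zero M] [One M] [LE M] [EFun M]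

/-- Interpretation of `≤` in `L_e`. [folklore] -/
@[simp]
theorem Language.orderedERing.relMap_le (v : Fin 2 → M) :
    RelMap (L := Language.orderedERing)
      (Sum.inl Language.orderRel.le : Language.orderedERing.Relations 2) v ↔ v 0 ≤ v 1 :=
  Iff.rfl

/-- An `L_e`-structure given by its operations, order and `e` is an ordered structure in
Mathlib's sense (`≤` is the interpretation of the order symbol). [folklore] -/
instance Language.orderedERing.instOrderedStructure : Language.orderedERing.OrderedStructure M :=
  ⟨fun v => Language.orderedERing.relMap_le v⟩

end Ordered

/-! ### The explicit definition of `e` in `L_exp` -/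

/-- The `L_exp`-formula `∃ u (u · (1 + x · x) = 1 ∧ y = exp u)` in the variables `(y, x)`
defining the graph of `e` (den Besten 2016, proof of Lemma 6.2.3: "`e` is existentially
definable in terms of `exp`"). [cite: DenBesten2016, Lemma 6.2.3] -/
def eGraphFormula : Language.orderedExpRing.Formula (Fin 2) :=
  Formula.iExs Unit
    ((Term.equal (var (Sum.inr ()) * (1 + var (Sum.inl 1) * var (Sum.inl 1))) 1) ⊓
      (Term.equal (var (Sum.inl 0)) (Language.orderedExpRing.termExp (var (Sum.inr ())))))

/-- **The definition of `{e}` in `L_exp`**: `e` by `eGraphFormula` (no relation symbols).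
[cite: DenBesten2016, Lemma 6.2.3] -/
def eDefs : Definitions Language.orderedExpRing Language.eUnary where
  δ := fun {k} g =>
    match k, g with
    | _, eFunc.e => eGraphFormula
  ρ := fun r => r.elim

/-- Existential quantification over `Unit → M` is quantification over `M`. [folklore] -/
theorem exists_unit_fun_iff {M : Type*} {P : M → Prop} :
    (∃ c : Unit → M, P (c ())) ↔ ∃ u, P u :=
  ⟨fun ⟨c, h⟩ => ⟨c (), h⟩, fun ⟨u, h⟩ => ⟨fun _ => u, h⟩⟩

/-- In a field, `∃ u (u · (1 + a·a) = 1 ∧ y = E u)` says `E ((1 + a²)⁻¹) = y`, provided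
`1 + a·a ≠ 0`. [folklore] -/
theorem exists_mul_one_add_mul_self_eq_one_iff {F : Type*} [Field F] (E : F → F) {a y : F}
    (ha : 1 + a * a ≠ 0) :
    (∃ u, u * (1 + a * a) = 1 ∧ y = E u) ↔ E ((1 + a ^ 2)⁻¹) = y := by
  constructor
  · rintro ⟨u, hu, rfl⟩
    have : u = (1 + a ^ 2)⁻¹ := by
      rw [sq]; exact eq_inv_of_mul_eq_one_left hu
    rw [this]
  · intro h
    exact ⟨(1 + a ^ 2)⁻¹, by rw [sq]; exact inv_mul_cancel₀ ha, h.symm⟩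

/-- **`ℝ` with `e(x) = exp((1 + x²)⁻¹)` is the definitional expansion of `ℝ_exp` along `eDefs`.**
[cite: DenBesten2016, Lemma 6.2.3] -/
theorem eDefs_isDefinedBy_real : eDefs.IsDefinedBy ℝ where
  realize_δ_iff := by
    intro k g x y
    cases g
    have ha : (1 : ℝ) + x 0 * x 0 ≠ 0 := (add_pos_of_pos_of_nonneg one_pos (mul_self_nonneg _)).ne'
    simp only [eDefs, eGraphFormula, Formula.realize_iExs, Formula.realize_inf,
      Formula.realize_equal, Language.orderedExpRing.realize_mul,
      Language.orderedExpRing.realize_add, Language.orderedExpRing.realize_one, Term.realize_var,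
      Sum.elim_inr, Sum.elim_inl, Fin.cons_one, Fin.cons_zero,
      Language.orderedExpRing.realize_exp, Language.eUnary.funMap_e]
    rw [exists_unit_fun_iff (P := fun u => u * (1 + x 0 * x 0) = 1 ∧ y = ExponentialRing.exp u),
      exists_mul_one_add_mul_self_eq_one_iff _ ha]
    rfl
  realize_ρ_iff := by
    intro k r
    exact r.elim

namespace RealExpModel

variable (K : Language.Theory.ModelType.{0, 0, w} realExpTheory)

/-- **A model `K` of `T_exp` with `e(x) = exp((1 + x²)⁻¹)` is the definitional expansion of `K`
along `eDefs`.** [cite: DenBesten2016, Lemma 6.2.3] -/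
theorem eDefs_isDefinedBy : eDefs.IsDefinedBy K where
  realize_δ_iff := by
    intro k g x y
    cases g
    have ha : (1 : K) + x 0 * x 0 ≠ 0 := (add_pos_of_pos_of_nonneg one_pos (mul_self_nonneg _)).ne'
    simp only [eDefs, eGraphFormula, Formula.realize_iExs, Formula.realize_inf,
      Formula.realize_equal, realize_mul, realize_add, realize_one, Term.realize_var,
      Sum.elim_inr, Sum.elim_inl, Fin.cons_one, Fin.cons_zero, realize_termExp,
      Language.eUnary.funMap_e]
    rw [exists_unit_fun_iff (P := fun u => u * (1 + x 0 * x 0) = 1 ∧ y = exp u),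
      exists_mul_one_add_mul_self_eq_one_iff _ ha]
    rfl
  realize_ρ_iff := by
    intro k r
    exact r.elim

end RealExpModel

/-! ### The theory `T_e` -/

/-- **`T_e = Th(ℝ | L_e)`**, the complete theory of `(ℝ; +, ·, -, 0, 1, ≤, e)` with
`e(x) = exp((1 + x²)⁻¹)` (den Besten 2016, Definition 6.2.2; Wilkie 1996, §9 and Theorem 11.1).
[cite: DenBesten2016, Definition 6.2.2] -/
def eTheory : Language.orderedERing.Theory :=
  Language.orderedERing.completeTheory ℝ

/-- `ℝ` is a model of `T_e` (tautologically). [folklore] -/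
instance Real.model_eTheory : ℝ ⊨ eTheory :=
  Language.model_completeTheory

/-- `T_e` is complete (it is the complete theory of a structure). [folklore] -/
theorem eTheory_isComplete : eTheory.IsComplete :=
  Language.completeTheory.isComplete _ _

namespace RealExpModel

/-- **Every model of `T_exp`, with `e(x) = exp((1 + x²)⁻¹)`, satisfies `Th(ℝ; exp, e)`**: the
definitional expansions along `eDefs` of the elementarily equivalent `L_exp`-structures `K` and
`ℝ` are elementarily equivalent (`Definitions.IsDefinedBy.models_completeTheory_sum`).
[cite: DenBesten2016, Lemma 6.2.3] -/
theorem model_orderedExpERing_completeTheory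
    (K : Language.Theory.ModelType.{0, 0, 0} realExpTheory) :
    (K : Type) ⊨ Language.orderedExpERing.completeTheory ℝ :=
  (eDefs_isDefinedBy K).models_completeTheory_sum eDefs_isDefinedBy_real
    (show (K : Type) ⊨ Language.orderedExpRing.completeTheory ℝ from K.is_model)

/-- **Every model `K` of `T_exp` is a model of `T_e`** with `e(x) = exp((1 + x²)⁻¹)` (den Besten
2016, p. 75: "`k` and `K` are models of `T_e` as well (with the obvious interpretation of
`e`)"). [cite: DenBesten2016, Lemma 6.2.3] -/
instance model_eTheory (K : Language.Theory.ModelType.{0, 0, 0} realExpTheory) :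
    (K : Type) ⊨ eTheory := by
  refine ⟨fun σ hσ => ?_⟩
  have hR : ℝ ⊨ orderedERingHom.onSentence σ :=
    (LHom.realize_onSentence ℝ orderedERingHom σ).2 (Language.mem_completeTheory.1 hσ)
  have hK : (K : Type) ⊨ orderedERingHom.onSentence σ :=
    (model_orderedExpERing_completeTheory K).realize_of_mem _ (Language.mem_completeTheory.2 hR)
  exact (LHom.realize_onSentence K orderedERingHom σ).1 hK

/-- **Transfer principle for `L_e`-sentences**: an `L_e`-sentence holds in a model of `T_exp`
iff it holds in `ℝ` (`T_e` is complete). [cite: DenBesten2016, Definition 6.2.2] -/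
theorem realize_eSentence_iff_real (K : Language.Theory.ModelType.{0, 0, 0} realExpTheory)
    (σ : Language.orderedERing.Sentence) : (K : Type) ⊨ σ ↔ ℝ ⊨ σ := by
  constructor
  · intro h
    by_contra hR
    have h' : ℝ ⊨ σ.not := hR
    exact ((model_eTheory K).realize_of_mem _ (Language.mem_completeTheory.2 h')) h
  · intro h
    exact (model_eTheory K).realize_of_mem _ (Language.mem_completeTheory.2 h)

/-- The `e`-reduct `K | L_e` of a model of `T_exp`, bundled as a model of `T_e`
(den Besten 2016, p. 75). [cite: DenBesten2016, Lemma 6.2.3] -/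
def eModel (K : Language.Theory.ModelType.{0, 0, 0} realExpTheory) :
    Language.Theory.ModelType.{0, 0, 0} eTheory :=
  ⟨K⟩

/-- The carrier of `eModel K` is that of `K`. [folklore] -/
@[simp]
theorem coe_eModel (K : Language.Theory.ModelType.{0, 0, 0} realExpTheory) :
    (eModel K : Type) = K :=
  rfl

/-! ### `L_e`-definable sets are `L_exp`-definable -/

variable (K : Language.Theory.ModelType.{0, 0, w} realExpTheory)

/-- **Every subset of `Kⁿ` definable in `K | L_e` (with parameters `A`) is definable in the
`L_exp`-structure `K` with the same parameters** — `e` is `L_exp`-definable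
(den Besten 2016, Lemma 6.2.3; `Definitions.IsDefinedBy.definable_of_definable_sum`).
[cite: DenBesten2016, Lemma 6.2.3] -/
theorem definable_of_definable_orderedERing {A : Set K} {α : Type*} {s : Set (α → K)}
    (h : A.Definable Language.orderedERing s) : A.Definable Language.orderedExpRing s :=
  (eDefs_isDefinedBy K).definable_of_definable_sum (h.map_expansion orderedERingHom)

end RealExpModel

/-- Every subset of `ℝⁿ` definable in `(ℝ; +, ·, ≤, e)` is definable in `ℝ_exp` (same
parameters). [cite: DenBesten2016, Lemma 6.2.3] -/
theorem Real.definable_of_definable_orderedERing {A : Set ℝ} {α : Type*} {s : Set (α → ℝ)}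
    (h : A.Definable Language.orderedERing s) : A.Definable Language.orderedExpRing s :=
  eDefs_isDefinedBy_real.definable_of_definable_sum (h.map_expansion orderedERingHom)

/-! ### Embeddings of models of `T_exp` are `L_e`-embeddings -/

namespace RealExpModel

variable {k K : Language.Theory.ModelType.{0, 0, w} realExpTheory}
  (f : k ↪[Language.orderedExpRing] K)

/-- Embeddings of models of `T_exp` preserve inverses. [folklore] -/
@[simp]
theorem map_inv (a : k) : f a⁻¹ = (f a)⁻¹ :=
  map_inv₀ (toRingHom f) a

/-- **Embeddings of models of `T_exp` commute with `e`**: `f(e(a)) = e(f(a))`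
(den Besten 2016, p. 75: `k ⊆ K` "are models of `T_e` as well"). [cite: DenBesten2016, Lemma 6.2.3] -/
@[simp]
theorem map_e (a : k) : f (EFun.e a) = EFun.e (f a) := by
  rw [e_def, e_def, map_exp, map_inv]
  simp [sq]

/-- **An embedding `f : k ↪ K` of models of `T_exp` as an embedding of `L_e`-structures**
(same underlying map). [cite: DenBesten2016, Lemma 6.2.3] -/
def eEmbedding : k ↪[Language.orderedERing] K where
  toFun := f
  inj' := f.injective
  map_fun' := by
    intro n g x
    rcases g with g | g
    · cases g
      · exact map_add f (x 0) (x 1)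
      · exact map_mul f (x 0) (x 1)
      · exact map_neg f (x 0)
      · exact map_zero f
      · exact map_one f
    · cases g
      rw [Language.orderedERing.funMap_e, Language.orderedERing.funMap_e]
      exact map_e f (x 0)
  map_rel' := by
    intro n r x
    rcases r with r | r
    · cases r
      rw [Language.orderedERing.relMap_le, Language.orderedERing.relMap_le]
      exact map_le_iff f (x 0) (x 1)
    · exact r.elim

/-- The underlying map of `eEmbedding f` is `f`. [folklore] -/
@[simp]
theorem eEmbedding_apply (a : k) : eEmbedding f a = f a :=
  rfl

end RealExpModel

end Literature.ModelTheory.ExponentialFields
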